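import Summits.AtomisticToContinuum.HydrodynamicLimit.Theses.InformationPercolationEngine
import Summits.AtomisticToContinuum.HydrodynamicLimit.Theses.LimitCollisionMeasure
import Summits.AtomisticToContinuum.HydrodynamicLimit.Theorems.InformationPercolationEngineChaosClosesEulerMaxwellianMoments
import Summits.AtomisticToContinuum.HydrodynamicLimit.Theorems.InformationPercolationEngineChaosClosesEulerWeakLimitToolkit
import Summits.AtomisticToContinuum.HydrodynamicLimit.Theorems.InformationPercolationEngineChaosClosesEulerBalanceTestFamily
import Summits.AtomisticToContinuum.HydrodynamicLimit.Theorems.InformationPercolationEngineChaosClosesEulerQuantitativeRigidityC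
import HarnessLib

/-!
# Quantitative Maxwellian rigidity by compactness

Helper for the line `Sketch` of the crux `InformationPercolationEngine.ChaosClosesEuler`
(stmt-AtomisticToContinuum-15141), skeleton v13 (`Cruxes/ChaosClosesEuler/Lines/Sketch.lean`), registered stub
`stub_quantitativeRigidity`: `LimitCollisionMeasure.BalanceRigidity → WeakLimitToolkit → MaxwellianMoments → BalanceTestFamily → QuantitativeRigidity` (bodies VERBATIM the skeleton defs): a countable test family on which small collisional balance defects, a mass window, a temperature floor and a tail schedule force the `ψ`-moments of a finite measure on `ℝ³` to be close to those of the Maxwellian with its own parameters.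

Proof (files `…QuantitativeRigidityA/B/C.lean`): by contradiction and compactness — a bad sequence has a
weakly convergent subsequence (tail schedule ⇒ uniformly integrable second moments ⇒ tightness, Prokhorov);
the weak-limit toolkit passes moments and the balance functional to the limit, which is balanced on the test
family, hence on all bounded continuous tests, hence (Boltzmann's rigidity) a point mass — excluded by the
temperature floor — or a Maxwellian whose parameters are the limits of the own parameters; continuity of the
Maxwellian pairing in the parameters gives the contradiction (`quantitativeRigidity_aux`).

References: C. Cercignani, R. Illner, M. Pulvirenti, *The Mathematical Theory of Dilute Gases* (1994), §3.2 (uniqueness of collision equilibria); P. Billingsley, *Convergence of Probability Measures* (1999), §5 (Prokhorov).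
-/

noncomputable section

namespace Summit.AtomisticToContinuum.HydrodynamicLimit.Theorems.ChaosClosesEulerQuantitativeRigidity

open scoped BigOperators Topology Classical MeasureTheory ENNReal InnerProductSpace
open Filter Set MeasureTheory
open Literature.MathematicalPhysics.KineticTheory
open Literature.Analysis.FluidPDE
open Summit.AtomisticToContinuum.HydrodynamicLimit.Theses
open Summit.AtomisticToContinuum.HydrodynamicLimit.Theses.InformationPercolationEngine

/-- Registered stub `stub_quantitativeRigidity` of skeleton v13 (line `Sketch`, crux stmt-AtomisticToContinuum-15141): `LimitCollisionMeasure.BalanceRigidity → WeakLimitToolkit → MaxwellianMoments → BalanceTestFamily → QuantitativeRigidity` (bodies VERBATIM the skeleton defs): a countable test family on which small collisional balance defects, a mass window, a temperature floor and a tail schedule force the `ψ`-moments of a finite measure on `ℝ³` to be close to those of the Maxwellian with its own parameters. [folklore] -/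
theorem stub_quantitativeRigidity :
    LimitCollisionMeasure.BalanceRigidity →
    (∀ (μs : ℕ → FiniteMeasure V3) (μ : FiniteMeasure V3), Tendsto μs atTop (𝓝 μ) →
      (∀ n, Integrable (fun v : V3 => ‖v‖ ^ 2) (μs n : Measure V3)) →
      (∀ ε : ℝ, 0 < ε → ∃ L : ℝ, ∀ n, ∫ v in {v : V3 | L < ‖v‖}, ‖v‖ ^ 2 ∂(μs n : Measure V3) ≤ ε) →
      let Bal : (V3 → ℝ) → Measure V3 → ℝ := fun ψ m =>
        ∫ v, ∫ w, ∫ ω : Metric.sphere (0 : V3) 1,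
          hardSphereKernel (v, w) ω * (ψ (collide ω (v, w)).1 + ψ (collide ω (v, w)).2 - ψ v - ψ w) ∂sphereMeasure ∂m ∂m
      Integrable (fun v : V3 => ‖v‖ ^ 2) (μ : Measure V3) ∧
      Tendsto (fun n => ((μs n : Measure V3) Set.univ).toReal) atTop (𝓝 ((μ : Measure V3) Set.univ).toReal) ∧
      (∀ j : Fin 3, Tendsto (fun n => ∫ v, v j ∂(μs n : Measure V3)) atTop (𝓝 (∫ v, v j ∂(μ : Measure V3)))) ∧
      (∀ j k : Fin 3, Tendsto (fun n => ∫ v, v j * v k ∂(μs n : Measure V3)) atTop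
        (𝓝 (∫ v, v j * v k ∂(μ : Measure V3)))) ∧
      Tendsto (fun n => ∫ v, ‖v‖ ^ 2 ∂(μs n : Measure V3)) atTop (𝓝 (∫ v, ‖v‖ ^ 2 ∂(μ : Measure V3))) ∧
      (∀ ψ : V3 → ℝ, Continuous ψ → (∃ C : ℝ, ∀ v, |ψ v| ≤ C) →
        Tendsto (fun n => Bal ψ (μs n : Measure V3)) atTop (𝓝 (Bal ψ (μ : Measure V3))))) →
    (∀ (ρ θ : ℝ) (u : V3), 0 < ρ → 0 < θ →
      let m : Measure V3 := volume.withDensity (fun v => ENNReal.ofReal (localMaxwellian ρ θ u v))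
      IsFiniteMeasure m ∧ Integrable (fun v : V3 => ‖v‖ ^ 2) m ∧
      (m Set.univ).toReal = ρ ∧ (∀ j : Fin 3, ∫ v, v j ∂m = ρ * u j) ∧
      (∀ j k : Fin 3, ∫ v, v j * v k ∂m = ρ * (u j * u k + if j = k then θ else 0)) ∧
      (∫ v, ‖v‖ ^ 2 ∂m = ρ * (‖u‖ ^ 2 + 3 * θ)) ∧
      (∀ ψ : V3 → ℝ, Continuous ψ → (∃ C : ℝ, ∀ v, |ψ v| ≤ C) →
        Integrable ψ m ∧ ∫ v, ψ v ∂m = ρ * ∫ v, ψ v * localMaxwellian 1 θ u v)) →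
    (∃ ψs : ℕ → V3 → ℝ, (∀ i, Continuous (ψs i)) ∧ (∀ i v, |ψs i v| ≤ 1) ∧
      let Bal : (V3 → ℝ) → Measure V3 → ℝ := fun ψ m =>
        ∫ v, ∫ w, ∫ ω : Metric.sphere (0 : V3) 1,
          hardSphereKernel (v, w) ω * (ψ (collide ω (v, w)).1 + ψ (collide ω (v, w)).2 - ψ v - ψ w) ∂sphereMeasure ∂m ∂m
      ∀ m : Measure V3, IsFiniteMeasure m → Integrable (fun v : V3 => ‖v‖ ^ 2) m →
        (∀ i, Bal (ψs i) m = 0) →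
        ∀ ψ : V3 → ℝ, Continuous ψ → (∃ C : ℝ, ∀ v, |ψ v| ≤ C) → Bal ψ m = 0) →
    ∃ ψs : ℕ → V3 → ℝ, (∀ i, Continuous (ψs i)) ∧ (∀ i v, |ψs i v| ≤ 1) ∧
      ∀ (Lt : ℕ → ℝ) (ρ₁ ρ₂ θ₁ : ℝ), 0 < ρ₁ → 0 < θ₁ →
      ∀ ψ : V3 → ℝ, Continuous ψ → (∃ C : ℝ, ∀ v, |ψ v| ≤ C) →
      ∀ ε : ℝ, 0 < ε → ∃ n : ℕ, ∀ m : Measure V3, IsFiniteMeasure m →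
      Integrable (fun v : V3 => ‖v‖ ^ 2) m →
      ρ₁ ≤ (m Set.univ).toReal → (m Set.univ).toReal ≤ ρ₂ →
      (∀ j : ℕ, j ≤ n → ∫ v in {v : V3 | Lt j < ‖v‖}, ‖v‖ ^ 2 ∂m ≤ 1 / ((j : ℝ) + 1)) →
      let Bal : (V3 → ℝ) → Measure V3 → ℝ := fun ψ m =>
        ∫ v, ∫ w, ∫ ω : Metric.sphere (0 : V3) 1,
          hardSphereKernel (v, w) ω * (ψ (collide ω (v, w)).1 + ψ (collide ω (v, w)).2 - ψ v - ψ w) ∂sphereMeasure ∂m ∂m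
      let ρm : ℝ := (m Set.univ).toReal
      let um : V3 := ρm⁻¹ • ∫ v, v ∂m
      let θm : ℝ := 2 / 3 * ((∫ v, ‖v‖ ^ 2 / 2 ∂m) / ρm - ‖∫ v, v ∂m‖ ^ 2 / (2 * ρm ^ 2))
      θ₁ ≤ θm → (∀ i : ℕ, i < n → |Bal (ψs i) m| ≤ 1 / ((n : ℝ) + 1)) →
      |(∫ v, ψ v ∂m) - ρm * ∫ v, ψ v * localMaxwellian 1 θm um v| ≤ ε := by
  intro hBR hWL hMM hBTF
  obtain ⟨ψs, hψc, hψb, hdet⟩ := hBTF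
  refine ⟨ψs, hψc, hψb, ?_⟩
  intro Lt ρ₁ ρ₂ θ₁ hρ₁ hθ₁ ψ hψ hC ε hε
  obtain ⟨n, hn⟩ := quantitativeRigidity_aux hBR hWL hMM hψc hψb hdet Lt hρ₁ hθ₁ hψ hC hε
  exact ⟨n, hn⟩

end Summit.AtomisticToContinuum.HydrodynamicLimit.Theorems.ChaosClosesEulerQuantitativeRigidity
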